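import Summits.HodgeConjecture.HodgeCM.PerL34.PseudoEisenstein_2

/-! PORT of `HodgeCM/PerL34/PseudoEisenstein.lean` (HodgeCMPerL run 82) — part 3: continuation of `Summits.HodgeConjecture.HodgeCM.PerL34.PseudoEisenstein_2` (split at a top-level declaration boundary by port_pkg.py; scope re-opened below; declarations unchanged). -/

-- port_pkg: scope re-opened for this part (file-level context, then the namespace/section stack open at the cut)
set_option autoImplicit false
noncomputable section
open MeasureTheory Set Filter Function
open scoped Pointwise ENNReal
namespace HodgeCM
namespace PerL34
namespace N23a
section FundamentalLemma
variable {G : Type*} [TopologicalSpace G] [T2Space G] [LocallyCompactSpace G]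
  [MeasurableSpace G] [OpensMeasurableSpace G]
/-- **Fundamental lemma of the calculus of variations, continuous form.** If `φ` is continuous,
`μ` charges every non-empty open set (every Haar measure does) and `∫ f·φ dμ = 0` for every
continuous compactly supported `f`, then `φ = 0` — test against `f = ψ·φ̄` for a bump `ψ`. -/
theorem eq_zero_of_forall_integral_mul_eq_zero (μ : Measure G) [μ.IsOpenPosMeasure]
    [IsFiniteMeasureOnCompacts μ] (φ : G → ℂ) (hφ : Continuous φ)
    (h : ∀ f : G → ℂ, Continuous f → HasCompactSupport f → ∫ x, f x * φ x ∂μ = 0) :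
    φ = 0 := by
  funext x₀
  -- a bump `ψ ∈ C_c(G)`, `0 ≤ ψ ≤ 1`, `ψ x₀ = 1`
  obtain ⟨K, hK, hKx⟩ := exists_compact_mem_nhds x₀
  have hx₀ : x₀ ∈ interior K := mem_interior_iff_mem_nhds.2 hKx
  have hcl : IsCompact (closure (interior K)) :=
    hK.closure.of_isClosed_subset isClosed_closure (closure_mono interior_subset)
  obtain ⟨ψ, hψs, hψ1, hψ01⟩ := exists_tsupport_one_of_isOpen_isClosed isOpen_interior hcl
    isClosed_singleton (Set.singleton_subset_iff.2 hx₀)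
  have hψc : HasCompactSupport (ψ : G → ℝ) :=
    hcl.of_isClosed_subset (isClosed_tsupport _) (hψs.trans subset_closure)
  have hψx₀ : ψ x₀ = 1 := hψ1 (Set.mem_singleton x₀)
  -- the test function `f = ψ · conj φ`
  set f : G → ℂ := fun x => (ψ x : ℂ) * (starRingEnd ℂ) (φ x) with hf
  have hfc : Continuous f :=
    (Complex.continuous_ofReal.comp ψ.continuous).mul (Complex.continuous_conj.comp hφ)
  have hfs : HasCompactSupport f := by
    have h1 : HasCompactSupport fun x => (ψ x : ℂ) := hψc.comp_left Complex.ofReal_zero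
    exact h1.mul_right
  have h0 := h f hfc hfs
  have hreal : ∫ x, f x * φ x ∂μ = ((∫ x, ψ x * ‖φ x‖ ^ 2 ∂μ : ℝ) : ℂ) := by
    rw [← integral_complex_ofReal]
    congr 1
    ext x
    simp only [hf]
    rw [mul_assoc, Complex.conj_mul']
    push_cast
    ring
  rw [hreal] at h0
  have h0' : ∫ x, ψ x * ‖φ x‖ ^ 2 ∂μ = 0 := by exact_mod_cast h0
  have hgc : Continuous fun x => ψ x * ‖φ x‖ ^ 2 :=
    ψ.continuous.mul ((continuous_norm.comp hφ).pow 2)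
  have hgs : HasCompactSupport fun x => ψ x * ‖φ x‖ ^ 2 := hψc.mul_right
  have hgnn : 0 ≤ fun x => ψ x * ‖φ x‖ ^ 2 := fun x => mul_nonneg (hψ01 x).1 (sq_nonneg _)
  have hae := (integral_eq_zero_iff_of_nonneg hgnn (hgc.integrable_of_hasCompactSupport hgs)).1 h0'
  have heq : (fun x => ψ x * ‖φ x‖ ^ 2) = 0 :=
    (Continuous.ae_eq_iff_eq μ hgc continuous_zero).1 hae
  have hx := congr_fun heq x₀
  simp only [Pi.zero_apply, hψx₀, one_mul] at hx
  show φ x₀ = 0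
  exact norm_eq_zero.1 ((pow_eq_zero_iff two_ne_zero).1 hx)

end FundamentalLemma

section Consequence

variable {G : Type*} [Group G] [TopologicalSpace G] [IsTopologicalGroup G] [T2Space G]
  [LocallyCompactSpace G] [MeasurableSpace G] [BorelSpace G]
  {T : Type*} [Group T] [TopologicalSpace T] [T2Space T] [MeasurableSpace T] [OpensMeasurableSpace T]

omit [T2Space G] [LocallyCompactSpace G] [MeasurableSpace G] [BorelSpace G] [T2Space T] in
/-- Continuity of the truncated toric period `h ↦ ∫_T β(t) conj χ(t) v(jT(t) h) dν` of a continuous `v`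
(the function `h ↦ P_{T,χ̄}(R(h)v)` of tex l. 425, "continuous" l. 426). -/
theorem continuous_toricPeriod_conj (ν : Measure T) [IsFiniteMeasureOnCompacts ν]
    (jT : T →* G) (hjT : Continuous jT)
    (β : T → ℝ) (hβ : Continuous β) (hβs : HasCompactSupport β)
    (χ : T → ℂ) (hχ : Continuous χ) (v : G → ℂ) (hv : Continuous v) :
    Continuous fun h : G => ∫ t, ((β t : ℂ) * (starRingEnd ℂ) (χ t)) * v (jT t * h) ∂ν := by
  have hk : IsCompact (tsupport β) := hβs
  have hF : ContinuousOn (Function.uncurry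
      fun (h : G) (t : T) => ((β t : ℂ) * (starRingEnd ℂ) (χ t)) * v (jT t * h)) (univ ×ˢ univ) := by
    apply Continuous.continuousOn
    change Continuous fun p : G × T => ((β p.2 : ℂ) * (starRingEnd ℂ) (χ p.2)) * v (jT p.2 * p.1)
    exact (((Complex.continuous_ofReal.comp (hβ.comp continuous_snd)).mul
      (Complex.continuous_conj.comp (hχ.comp continuous_snd))).mul
      (hv.comp ((hjT.comp continuous_snd).mul continuous_fst)))
  have hzero : ∀ (p : G) (t : T), p ∈ (univ : Set G) → t ∉ tsupport β →
      (fun (h : G) (t : T) => ((β t : ℂ) * (starRingEnd ℂ) (χ t)) * v (jT t * h)) p t = 0 := by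
    intro p t _ ht
    simp only [image_eq_zero_of_notMem_tsupport ht, Complex.ofReal_zero, zero_mul]
  have h := continuousOn_integral_of_compact_support (μ := ν) hk hF hzero
  exact continuousOn_univ.mp h

/-- **Step 2, consequence form (tex ll. 423–426), kernel-proved in the model.** If `v` (continuous,
left-`Γ`-invariant — a vector of `L²([U(W)])` realised as a function) is orthogonal to every
pseudo-Eisenstein series `E^χ_f`, `f ∈ C_c(G)`, then the toric period of every right translate
vanishes: `P^β_{T,χ̄}(R(h)v) = ∫_T β conj χ · v(jT(·) h) dν = 0` for ALL `h ∈ G`.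
(`unfolding_inner` + the fundamental lemma `eq_zero_of_forall_integral_mul_eq_zero`; this is the
content of the residual input `unfold` of the N23c split `Annihilation.lean`, in this model.) -/
theorem toricPeriod_transl_eq_zero_of_orthogonal
    (μ : Measure G) [μ.IsMulLeftInvariant] [IsFiniteMeasureOnCompacts μ] [μ.IsOpenPosMeasure]
    (ν : Measure T) [IsFiniteMeasureOnCompacts ν]
    (jT : T →* G) (hjT : Continuous jT)
    (β : T → ℝ) (hβ : Continuous β) (hβs : HasCompactSupport β)
    (χ : T → ℂ) (hχ : Continuous χ)
    (Γ : Subgroup G) [Countable Γ] (𝓕 : Set G) (h𝓕 : IsFundamentalDomain Γ 𝓕 μ)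
    (v : G → ℂ) (hv : Continuous v) (hvinv : ∀ (γ : Γ) (y : G), v ((γ : G) * y) = v y)
    (horth : ∀ f : G → ℂ, Continuous f → HasCompactSupport f →
      ∫ y in 𝓕, Eis ν jT β χ Γ f y * (starRingEnd ℂ) (v y) ∂μ = 0)
    (h : G) :
    ∫ t, ((β t : ℂ) * (starRingEnd ℂ) (χ t)) * v (jT t * h) ∂ν = 0 := by
  set φ : G → ℂ := fun h => (starRingEnd ℂ) (∫ t, ((β t : ℂ) * (starRingEnd ℂ) (χ t)) * v (jT t * h) ∂ν)
    with hφdef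
  have hφ : Continuous φ :=
    Complex.continuous_conj.comp (continuous_toricPeriod_conj ν jT hjT β hβ hβs χ hχ v hv)
  have hzero : φ = 0 := by
    refine eq_zero_of_forall_integral_mul_eq_zero μ φ hφ ?_
    intro f hf hfs
    rw [← unfolding_inner μ ν jT hjT β hβ hβs χ hχ Γ 𝓕 h𝓕 f hf hfs v hv hvinv]
    exact horth f hf hfs
  have hh := congr_fun hzero h
  simpa [hφdef] using hh

end Consequence

end N23a
end PerL34
end HodgeCM

end
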